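import Literature.IUT.HodgeArakelov.LabelClassesOfCuspsSeparationTransport
import HarnessLib

/-!
# [IUTchII] Def 2.3 (iii)/(v): `|LabCusp^±(Π̂^±_v)| = l` ALSO for the TEMPERED-level cuspidal datum (A) of the genuine tower — homogeneity
# through a subgroup `R` with `R · Π̂^±_v = Π̂^cor_v`

S. Mochizuki, *Inter-universal Teichmüller theory II*, kurims manuscript (Dec. 2020), §2 Def 2.3 (ii)/(iii) p. 68, (v) p. 69, Rmk 2.3.1 p. 69
[claim: Mochizuki2012, status: disputed] (IUTchII §2 Def 2.3 (iii), kurims p.68) (D-0012 claim key; record-only).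

abc-iut cell, seat abc-iut-w5-d132 (gen 6), row «DEF23V-CARD-A» (self-named sequel to p447018/p449023; MERGE note 14:4xZ): the count of
`±`-label classes at the hatted level does not need ALL `Π̂^cor_v`-conjugates of `J₀` to be cuspidal — it suffices that the cuspidal
groups of `Π̂^±_v` are the `R`-conjugates of `J₀` for a subgroup `R` with `R · Π̂^±_v = Π̂^cor_v` (e.g. `R = Π^cor_v = ι(Π^tp_C)`, DENSE),
which is the shape of the TEMPERED-level datum (A) of abc-iut-w5-d132's p430433 / abc-iut-L6-t7's B15 agreement (cusps of `Π^±_v` = the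
`Π^±_v`-conjugates of `ι((g·inclX I_x·g⁻¹) ∩ inclX Π^tp_{X̲_v})`, `g ∈ Π^tp_C`; at level `Π̂^±_v` listed by containment).  PROOF-ONLY
(no `def`, no instance, no new named fact):

* `index_subgroupOf_eq_index_of_sup_eq_top` — group theory: `P ⊴ G`, `P ≤ S`, `R ⊔ P = ⊤` ⇒ `[R : R ∩ S] = [G : S]`;
* `card_labCuspPM_eq_relIndex_of_sup` / `card_labCuspPM_eq_index_of_sup` — `|LabCusp^±(Π̂^±_v)| = [Π̂^cor_v : N(N(J₀) ∩ Π̂^±_v)·Π̂^±_v]` for an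
  `R`-homogeneous datum (orbit–stabiliser through `R`), generalising p447018's `card_labCuspPM_eq_index` (`R = ⊤`);
* `index_normalizer_sup_pmHat_eq_l` — the index arithmetic `2l / 2 = l` of p447018 as a standalone lemma;
* **`card_labCuspPM_eq_l_of_inputs_of_sup`** — the count `= l` for an `R`-homogeneous datum from the same inputs (separation, inversion);
* **`isCuspidalInertia_pmHat_iff_cor`** — at the genuine tower, a datum with the p430433 characterisation (tempered family, `t ∈ Π^±_v`) is
  `Π^cor_v`-homogeneous at level `Π̂^±_v`: «`J` cuspidal in `Π̂^±_v` ⟺ `J = r J₀ r⁻¹`, `r ∈ Π^cor_v = ι(Π^tp_C)`»;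
* **`card_labCuspPM_ofCoverModel_eq_l_tempered`**, **`card_labCuspPM_ofPiCHat_eq_l_tempered`** — `|LabCusp^±(Π̂^±_v)| = l` for every datum with
  the p430433 characterisation, modulo the same named residuals as p449023 (`h45vi` = [AbsTopI] Lem 4.5 (vi) F-0207 at the instance — or, via
  p450846/p451111, [GalSect] Thm 1.3 (ii) F-0103 BY NAME —, F-1674, `op`, «unique cusp», L02 `hZ`, `hN`).

HONEST LABEL: the successor structure `FlTorsorStructureConj` is NOT available on datum (A) (its hatted cusps are not `Π̂^cor_v`-stable: law (a)
fails there by construction, GAP-LEDGER G-w5d243-1) — only the COUNT transfers; the torsor structure lives on p432649's profinite datum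
(p450102).  Nothing of the series is asserted; no side taken on [IUTchIII] Cor 3.12; typed ≠ proved.
-/

noncomputable section

open scoped Pointwise

namespace Literature.IUT.HodgeArakelov

universe u

/-- Pushing a conjugate forward: `f(a H a⁻¹) = f(a) f(H) f(a)⁻¹`. [folklore] -/
private theorem map_conj_smul'' {A B : Type*} [Group A] [Group B] (f : A →* B) (a : A) (H : Subgroup A) :
    (MulAut.conj a • H).map f = MulAut.conj (f a) • H.map f := by
  rw [conj_smul_eq_map_conj, conj_smul_eq_map_conj, Subgroup.map_map, Subgroup.map_map]
  congr 1
  ext x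
  simp [MulAut.conj_apply]

/-! ## 1. Group theory: index through a supplement of a normal subgroup -/

section GroupTheory

variable {G : Type*} [Group G]

/-- **`[R : R ∩ S] = [G : S]` when `R · P = G` for a normal `P ≤ S`**: both indices are the index of `S/P` in `G/P`, the maps `G ↠ G/P` and
`R ↠ G/P` being surjective. (conjugation/index bookkeeping for Def 2.3 (iii)) [claim: Mochizuki2012, status: disputed] (IUTchII §2 Def 2.3 (iii), kurims p.68) -/
theorem index_subgroupOf_eq_index_of_sup_eq_top {P S R : Subgroup G} [P.Normal] (hPS : P ≤ S) (hR : R ⊔ P = ⊤) :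
    (S.subgroupOf R).index = S.index := by
  set π : G →* G ⧸ P := QuotientGroup.mk' P with hπ
  have hker : π.ker ≤ S := by rw [hπ, QuotientGroup.ker_mk']; exact hPS
  have hS : (S.map π).comap π = S := Subgroup.comap_map_eq_self hker
  -- `R ↠ G/P`
  have hsurj : Function.Surjective (π.comp R.subtype) := by
    intro y
    obtain ⟨q, rfl⟩ := QuotientGroup.mk_surjective y
    have hq : q ∈ R ⊔ P := by rw [hR]; trivial
    rw [← SetLike.mem_coe, Subgroup.mul_normal] at hq
    obtain ⟨r, hr, m, hm, rfl⟩ := Set.mem_mul.mp hq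
    refine ⟨⟨r, hr⟩, ?_⟩
    have hm1 : π m = 1 := by
      rw [hπ, QuotientGroup.mk'_apply, QuotientGroup.eq_one_iff]
      exact SetLike.mem_coe.mp hm
    change π r = π (r * m)
    rw [map_mul, hm1, mul_one]
  have h1 : (S.subgroupOf R).index = (S.map π).index := by
    rw [Subgroup.subgroupOf, ← hS, Subgroup.comap_comap, Subgroup.index_comap_of_surjective _ hsurj, hS]
  have h2 : S.index = (S.map π).index := by
    conv_lhs => rw [← hS]
    exact Subgroup.index_comap_of_surjective _ (QuotientGroup.mk'_surjective P)
  rw [h1, h2]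

end GroupTheory

/-! ## 2. The count for an `R`-homogeneous cuspidal datum -/

section Homogeneous

variable {S : BadPlaceSetting.{u}} {P : TopGroup.{u}} {T : TemperedCoverings S P} {W : PlusMinusTower T}
variable {C : CuspidalInertiaData W} {J₀ : Subgroup W.Corhat} {R : Subgroup W.Corhat}

/-- **`|LabCusp^±(Π̂^±_v)|` as a RELATIVE INDEX for an `R`-homogeneous datum**: if the cusps of `Π̂^±_v` are exactly the `R`-conjugates of
`J₀ ≤ Π̂^±_v`, then `r ↦ ⟦r J₀ r⁻¹⟧` identifies `LabCusp^±(Π̂^±_v)` with `R / (R ∩ N(N(J₀) ∩ Π̂^±_v)·Π̂^±_v)`.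
[claim: Mochizuki2012, status: disputed] (IUTchII §2 Def 2.3 (iii), kurims p.68) -/
theorem card_labCuspPM_eq_relIndex_of_sup (hJ₀ : J₀ ≤ W.pmHat)
    (hC : ∀ J, C.IsCuspidalInertia W.pmHat J ↔ ∃ q ∈ R, J = MulAut.conj q • J₀) :
    Nat.card (LabCuspPM C W.pmHat W.pmHat) =
      ((Subgroup.normalizer ((Subgroup.normalizer (J₀ : Set W.Corhat) ⊓ W.pmHat : Subgroup W.Corhat) : Set W.Corhat) ⊔
        W.pmHat).subgroupOf R).index := by
  set Sg : Subgroup W.Corhat :=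
    Subgroup.normalizer ((Subgroup.normalizer (J₀ : Set W.Corhat) ⊓ W.pmHat : Subgroup W.Corhat) : Set W.Corhat) ⊔ W.pmHat
    with hSg
  have hcusp : ∀ q : R, C.IsCuspidalInertia W.pmHat (MulAut.conj (q : W.Corhat) • J₀) := fun q => (hC _).mpr ⟨q, q.2, rfl⟩
  let f : R → LabCuspPM C W.pmHat W.pmHat := fun q => Quot.mk _ ⟨MulAut.conj (q : W.Corhat) • J₀, hcusp q⟩
  have hf : ∀ a b : R, f a = f b ↔ a⁻¹ * b ∈ Sg.subgroupOf R := fun a b =>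
    (labCuspPM_mk_eq_mk_iff C W.pmHat W.pmHat _ _).trans
      ((labelRel_conj_smul_iff hJ₀ (hcusp a) (hcusp b)).trans (by rw [Subgroup.mem_subgroupOf]; rfl))
  have hfs : Function.Surjective f := by
    intro t
    induction t using Quot.ind with
    | mk J =>
      obtain ⟨q, hq, hJ⟩ := (hC J.1).mp J.2
      exact ⟨⟨q, hq⟩, congrArg (Quot.mk _) (Subtype.ext hJ.symm)⟩
  let F : R ⧸ Sg.subgroupOf R → LabCuspPM C W.pmHat W.pmHat := fun x =>
    Quotient.liftOn' x f fun a b hab => (hf a b).mpr (QuotientGroup.leftRel_apply.mp hab)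
  have hF : ∀ q, F (QuotientGroup.mk q) = f q := fun _ => rfl
  have hFbij : Function.Bijective F := by
    constructor
    · intro x y hxy
      obtain ⟨a, rfl⟩ := QuotientGroup.mk_surjective x
      obtain ⟨b, rfl⟩ := QuotientGroup.mk_surjective y
      rw [hF, hF, hf] at hxy
      exact QuotientGroup.eq.mpr hxy
    · intro t
      obtain ⟨q, rfl⟩ := hfs t
      exact ⟨QuotientGroup.mk q, hF q⟩
  rw [Subgroup.index_eq_card, Nat.card_congr (Equiv.ofBijective F hFbij)]

/-- **`|LabCusp^±(Π̂^±_v)|` AS AN INDEX for an `R`-homogeneous datum with `R · Π̂^±_v = Π̂^cor_v`** (e.g. `R = Π^cor_v`, dense): the same index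
as for the fully homogeneous datum of p447018, `[Π̂^cor_v : N(N(J₀) ∩ Π̂^±_v) · Π̂^±_v]`.
[claim: Mochizuki2012, status: disputed] (IUTchII §2 Def 2.3 (iii), kurims p.68) -/
theorem card_labCuspPM_eq_index_of_sup (hJ₀ : J₀ ≤ W.pmHat) (hR : R ⊔ W.pmHat = ⊤)
    (hC : ∀ J, C.IsCuspidalInertia W.pmHat J ↔ ∃ q ∈ R, J = MulAut.conj q • J₀) :
    Nat.card (LabCuspPM C W.pmHat W.pmHat) =
      (Subgroup.normalizer ((Subgroup.normalizer (J₀ : Set W.Corhat) ⊓ W.pmHat : Subgroup W.Corhat) : Set W.Corhat) ⊔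
        W.pmHat).index := by
  rw [card_labCuspPM_eq_relIndex_of_sup hJ₀ hC]
  exact index_subgroupOf_eq_index_of_sup_eq_top le_sup_right hR

/-- **The index arithmetic `2l / 2 = l`** (p447018's `card_labCuspPM_eq_l_of_inputs`, standalone): with `[Π̂^cor_v : Π̂^±_v] = 2l`, `Π̂_X` of index
`2` containing `Π̂^±_v`, `D ≤ Π̂^±_v` normalising `J₀`, separation `N(J₀) ∩ Π̂_X ≤ D`, `J₀` stable under `N(D)`, and an inversion `q₁ ∉ Π̂_X`
normalising `D`: `[Π̂^cor_v : N(N(J₀) ∩ Π̂^±_v)·Π̂^±_v] = l`. [claim: Mochizuki2012, status: disputed] (IUTchII §2 Def 2.3 (iii), kurims p.68) -/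
theorem index_normalizer_sup_pmHat_eq_l (W : PlusMinusTower T) {J₀ Xh D : Subgroup W.Corhat} (hXh : Xh.index = 2) (hPX : W.pmHat ≤ Xh)
    (hDP : D ≤ W.pmHat) (hDJ : D ≤ Subgroup.normalizer (J₀ : Set W.Corhat))
    (hsep : Subgroup.normalizer (J₀ : Set W.Corhat) ⊓ Xh ≤ D)
    (hJD : ∀ q : W.Corhat, MulAut.conj q • D = D → MulAut.conj q • J₀ = J₀)
    {q₁ : W.Corhat} (hq₁X : q₁ ∉ Xh) (hq₁D : MulAut.conj q₁ • D = D) (hidx : W.pmHat.index = 2 * S.l) :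
    (Subgroup.normalizer ((Subgroup.normalizer (J₀ : Set W.Corhat) ⊓ W.pmHat : Subgroup W.Corhat) : Set W.Corhat) ⊔
      W.pmHat).index = S.l := by
  haveI : Xh.Normal := Subgroup.normal_of_index_eq_two hXh
  have hN₀ : Subgroup.normalizer (J₀ : Set W.Corhat) ⊓ W.pmHat = D :=
    le_antisymm ((inf_le_inf_left _ hPX).trans hsep) (le_inf hDJ hDP)
  rw [hN₀]
  set N₂ : Subgroup W.Corhat := Subgroup.normalizer (D : Set W.Corhat) with hN₂
  have hN₂X : N₂ ⊓ Xh ≤ W.pmHat := by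
    rintro q ⟨hqD, hqX⟩
    have hqJ : MulAut.conj q • J₀ = J₀ := hJD q (mem_normalizer_iff_conj_smul_eq.mp hqD)
    exact hDP (hsep ⟨mem_normalizer_iff_conj_smul_eq.mpr hqJ, hqX⟩)
  have hinf : W.pmHat ⊓ N₂ = Xh ⊓ N₂ :=
    le_antisymm (inf_le_inf_right _ hPX) (le_inf (fun q hq => hN₂X ⟨hq.2, hq.1⟩) inf_le_right)
  have h2 : Xh.relIndex N₂ = 2 := by
    have hdvd : Xh.relIndex N₂ ∣ 2 := hXh ▸ Subgroup.relIndex_dvd_index_of_normal Xh N₂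
    rcases (Nat.dvd_prime Nat.prime_two).mp hdvd with h1 | h2
    · exact absurd h1 (relIndex_normalizer_ne_one hq₁X hq₁D)
    · exact h2
  have hrel : W.pmHat.relIndex (N₂ ⊔ W.pmHat) = 2 := by
    rw [Subgroup.relIndex_sup_right, ← Subgroup.inf_relIndex_right, hinf, Subgroup.inf_relIndex_right, h2]
  have hmul := Subgroup.relIndex_mul_index (le_sup_right : W.pmHat ≤ N₂ ⊔ W.pmHat)
  rw [hrel, hidx] at hmul
  exact Nat.eq_of_mul_eq_mul_left two_pos hmul

/-- **THE COUNT `= l` FOR AN `R`-HOMOGENEOUS DATUM** (`R · Π̂^±_v = Π̂^cor_v`) from the same inputs as p447018's `card_labCuspPM_eq_l_of_inputs`.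
[claim: Mochizuki2012, status: disputed] (IUTchII §2 Def 2.3 (iii), kurims p.68) -/
theorem card_labCuspPM_eq_l_of_inputs_of_sup (hJ₀ : J₀ ≤ W.pmHat) (hR : R ⊔ W.pmHat = ⊤)
    (hC : ∀ J, C.IsCuspidalInertia W.pmHat J ↔ ∃ q ∈ R, J = MulAut.conj q • J₀)
    {Xh D : Subgroup W.Corhat} (hXh : Xh.index = 2) (hPX : W.pmHat ≤ Xh) (hDP : D ≤ W.pmHat)
    (hDJ : D ≤ Subgroup.normalizer (J₀ : Set W.Corhat)) (hsep : Subgroup.normalizer (J₀ : Set W.Corhat) ⊓ Xh ≤ D)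
    (hJD : ∀ q : W.Corhat, MulAut.conj q • D = D → MulAut.conj q • J₀ = J₀)
    {q₁ : W.Corhat} (hq₁X : q₁ ∉ Xh) (hq₁D : MulAut.conj q₁ • D = D) (hidx : W.pmHat.index = 2 * S.l) :
    Nat.card (LabCuspPM C W.pmHat W.pmHat) = S.l := by
  rw [card_labCuspPM_eq_index_of_sup hJ₀ hR hC]
  exact index_normalizer_sup_pmHat_eq_l W hXh hPX hDP hDJ hsep hJD hq₁X hq₁D hidx

end Homogeneous

/-! ## 3. The tempered-level datum (A) of the genuine tower is `Π^cor_v`-homogeneous at level `Π̂^±_v` -/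

namespace PlusMinusTower

open Literature.AnabelianGeometry.EtaleTheta Literature.AnabelianGeometry.SemiGraphs

variable {p : ℕ} [Fact p.Prime] {M : MuTwoSetting p} (e : M.CLevelData)
  {E : M.toThetaSetting.EtaleThetaData} {l : ℕ} (C : E.DoubleUnderline l) {N : ℕ+}
  (μ : M.toThetaSetting.CyclotomeMod l N) (hC : M.toThetaSetting.Compat) (hS : M.toThetaSetting.Sec2Hyps)
  (hl : l.Prime) (hp2 : p ≠ 2) (hpl : p ≠ l) (hζ : ∃ ζ : M.toThetaSetting.K, IsPrimitiveRoot ζ (4 * l))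
  {η : (C.thetaEnvData μ hC hS).PiYdd → MuN p N} (hη : η ∈ (C.thetaEnvData μ hC hS).thetaCocycles)
  {Q : Type} [Group Q] [TopologicalSpace Q] [IsTopologicalGroup Q]
  (ι : M.GtpC →ₜ* Q) (hι : IsProfiniteCompletion ι) (hinj : Function.Injective ι)
  (Φ : Q →* GQp p) (hΦ : ∀ g : M.GtpC, Φ (ι g) = e.augC g) (hΦK : Φ.range = M.GK)
  (hZ : Thm16Sub.KerToZIsCompactlyGenerated M.toThetaSetting) (hN : (C.Huu.subgroupOf (M.GtpXu l)).Normal)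
  {P : TopGroup.{0}} (T : TemperedCoverings (BadPlaceSetting.ofUnderline C μ hC hS hl hp2 hpl hζ hη) P) {x₀ : M.Pt}

include e hZ in
omit [IsTopologicalGroup Q] in
/-- The tempered cusp family IS the `ι(Π^tp_C)`-conjugates of `J₀` (no closure): `ι((g·inclX I_{x₀}·g⁻¹) ∩ inclX Π^tp_{X̲}) = ι(g) J₀ ι(g)⁻¹`
(p448608's `conj_map_inertia_inf_eq` pushed by `ι`). ([IUTchII] Rmk 2.3.1, kurims p.69) [claim: Mochizuki2012, status: disputed] -/
theorem cuspFamily_eq_conj (op : M.toThetaSetting.OncePuncturedData) (hx₀ : M.IsCusp x₀) (g : M.GtpC) :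
    ((((MulAut.conj g • (M.toTemperedCurve.inertia x₀).map M.inclX) ⊓ (M.GtpXu l).map M.inclX).map ι.toMonoidHom : Subgroup Q)) =
      MulAut.conj (ι g) • ((M.toTemperedCurve.inertia x₀).map M.inclX).map ι.toMonoidHom := by
  rw [conj_map_inertia_inf_eq e hZ op hx₀, map_conj_smul'']
  rfl

/-- **HOMOGENEITY THROUGH `Π^cor_v`** for the tempered datum (A): for ANY cuspidal datum `Cu` of the genuine tower with the p430433
characterisation (cusps at level `Π_□` = «`J ≤ Π_□` and `J = t · ι((g·inclX I_x·g⁻¹) ∩ inclX Π^tp_{X̲}) · t⁻¹`, `t ∈ Π^±_v`») and ONE cusp `x₀`: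
`J` is cuspidal in `Π̂^±_v` iff `J = r J₀ r⁻¹` for some `r ∈ Π^cor_v = ι(Π^tp_C)` (`Π^±_v ≤ Π^cor_v`).
([IUTchII] Def 2.3 (ii), Rmk 2.3.1, kurims pp.68–69) [claim: Mochizuki2012, status: disputed] -/
theorem isCuspidalInertia_pmHat_iff_cor (op : M.toThetaSetting.OncePuncturedData) (hx₀ : M.IsCusp x₀)
    (huniq : ∀ x' : M.Pt, M.IsCusp x' → x' = x₀)
    (Cu : CuspidalInertiaData (ofCoverModel e C μ hC hS hl hp2 hpl hζ hη ι hι hinj Φ hΦ hΦK hZ hN T))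
    (hCuA : ∀ Q' J : Subgroup (ofCoverModel e C μ hC hS hl hp2 hpl hζ hη ι hι hinj Φ hΦ hΦK hZ hN T).Corhat,
      Cu.IsCuspidalInertia Q' J ↔ J ≤ Q' ∧ ∃ i : {x : M.Pt // M.IsCusp x} × M.GtpC,
        ∃ t ∈ (ofCoverModel e C μ hC hS hl hp2 hpl hζ hη ι hι hinj Φ hΦ hΦK hZ hN T).piPM,
          J = MulAut.conj t •
            (((MulAut.conj i.2 • (M.toTemperedCurve.inertia i.1.1).map M.inclX) ⊓ (M.GtpXu l).map M.inclX).map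
              ι.toMonoidHom : Subgroup (ofCoverModel e C μ hC hS hl hp2 hpl hζ hη ι hι hinj Φ hΦ hΦK hZ hN T).Corhat))
    (J : Subgroup (ofCoverModel e C μ hC hS hl hp2 hpl hζ hη ι hι hinj Φ hΦ hΦK hZ hN T).Corhat) :
    Cu.IsCuspidalInertia (ofCoverModel e C μ hC hS hl hp2 hpl hζ hη ι hι hinj Φ hΦ hΦK hZ hN T).pmHat J ↔
      ∃ r ∈ (ofCoverModel e C μ hC hS hl hp2 hpl hζ hη ι hι hinj Φ hΦ hΦK hZ hN T).cor,
        J = MulAut.conj r • (((M.toTemperedCurve.inertia x₀).map M.inclX).map ι.toMonoidHom :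
          Subgroup (ofCoverModel e C μ hC hS hl hp2 hpl hζ hη ι hι hinj Φ hΦ hΦK hZ hN T).Corhat) := by
  let ιW : M.GtpC →* (ofCoverModel e C μ hC hS hl hp2 hpl hζ hη ι hι hinj Φ hΦ hΦK hZ hN T).Corhat := ι.toMonoidHom
  have hfam : ∀ i : {x : M.Pt // M.IsCusp x} × M.GtpC,
      ((((MulAut.conj i.2 • (M.toTemperedCurve.inertia i.1.1).map M.inclX) ⊓ (M.GtpXu l).map M.inclX).map
        ι.toMonoidHom : Subgroup (ofCoverModel e C μ hC hS hl hp2 hpl hζ hη ι hι hinj Φ hΦ hΦK hZ hN T).Corhat)) =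
      MulAut.conj (ιW i.2) • (((M.toTemperedCurve.inertia x₀).map M.inclX).map ι.toMonoidHom :
        Subgroup (ofCoverModel e C μ hC hS hl hp2 hpl hζ hη ι hι hinj Φ hΦ hΦK hZ hN T).Corhat) := by
    rintro ⟨⟨x, hx⟩, g⟩
    obtain rfl := huniq x hx
    exact cuspFamily_eq_conj e ι hZ op hx g
  have hJ₀P : (((M.toTemperedCurve.inertia x₀).map M.inclX).map ι.toMonoidHom :
      Subgroup (ofCoverModel e C μ hC hS hl hp2 hpl hζ hη ι hι hinj Φ hΦ hΦK hZ hN T).Corhat) ≤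
        (ofCoverModel e C μ hC hS hl hp2 hpl hζ hη ι hι hinj Φ hΦ hΦK hZ hN T).pmHat := by
    change (((M.toTemperedCurve.inertia x₀).map M.inclX).map ι.toMonoidHom : Subgroup Q) ≤
      (((M.GtpXu l).map M.inclX).map ι.toMonoidHom).topologicalClosure
    exact (Subgroup.map_mono (Subgroup.map_mono (inertia_le_GtpXu op hx₀))).trans (Subgroup.le_topologicalClosure _)
  have hcor : ∀ c : M.GtpC, ιW c ∈ (ofCoverModel e C μ hC hS hl hp2 hpl hζ hη ι hι hinj Φ hΦ hΦK hZ hN T).cor := fun c => ⟨c, rfl⟩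
  rw [hCuA]
  constructor
  · rintro ⟨-, i, t, ht, rfl⟩
    refine ⟨t * ιW i.2, ?_, by rw [hfam i, map_mul, mul_smul]⟩
    exact Subgroup.mul_mem _ ((ofCoverModel e C μ hC hS hl hp2 hpl hζ hη ι hι hinj Φ hΦ hΦK hZ hN T).embP_le_cor ht) (hcor i.2)
  · rintro ⟨r, ⟨c, rfl⟩, rfl⟩
    refine ⟨(Subgroup.pointwise_smul_le_pointwise_smul_iff.mpr hJ₀P).trans_eq (Subgroup.Normal.conj_smul_eq_self _ _),
      ⟨⟨x₀, hx₀⟩, c⟩, 1, Subgroup.one_mem _, ?_⟩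
    rw [hfam, map_one, one_smul]
    rfl

/-- **`|LabCusp^±(Π̂^±_v)| = l` FOR THE TEMPERED DATUM (A) at the genuine tower `ofCoverModel`**: for every cuspidal datum with the p430433
characterisation, modulo the named residuals of p449023 (`h45vi` = [AbsTopI] Lem 4.5 (vi) F-0207 at the instance, F-1674, `op`, «unique cusp»,
`hZ`, `hN`). ([IUTchII] Def 2.3 (iii)/(v), kurims pp.68–69) [claim: Mochizuki2012, status: disputed] -/
theorem card_labCuspPM_ofCoverModel_eq_l_tempered (op : M.toThetaSetting.OncePuncturedData) (hx₀ : M.IsCusp x₀)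
    (huniq : ∀ x' : M.Pt, M.IsCusp x' → x' = x₀) (h65iii : M.toTemperedCurve.IsoPreservesCuspidalDecomp M.toTemperedCurve)
    (h45vi : Subgroup.normalizer ((((M.toTemperedCurve.inertia x₀).map M.inclX).map ι.toMonoidHom : Subgroup Q) : Set Q) ⊓
        (M.inclX.range.map ι.toMonoidHom).topologicalClosure ≤ ((M.decomp x₀).map M.inclX).map ι.toMonoidHom)
    (Cu : CuspidalInertiaData (ofCoverModel e C μ hC hS hl hp2 hpl hζ hη ι hι hinj Φ hΦ hΦK hZ hN T))
    (hCuA : ∀ Q' J : Subgroup (ofCoverModel e C μ hC hS hl hp2 hpl hζ hη ι hι hinj Φ hΦ hΦK hZ hN T).Corhat,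
      Cu.IsCuspidalInertia Q' J ↔ J ≤ Q' ∧ ∃ i : {x : M.Pt // M.IsCusp x} × M.GtpC,
        ∃ t ∈ (ofCoverModel e C μ hC hS hl hp2 hpl hζ hη ι hι hinj Φ hΦ hΦK hZ hN T).piPM,
          J = MulAut.conj t •
            (((MulAut.conj i.2 • (M.toTemperedCurve.inertia i.1.1).map M.inclX) ⊓ (M.GtpXu l).map M.inclX).map
              ι.toMonoidHom : Subgroup (ofCoverModel e C μ hC hS hl hp2 hpl hζ hη ι hι hinj Φ hΦ hΦK hZ hN T).Corhat)) :
    Nat.card (LabCuspPM Cu (ofCoverModel e C μ hC hS hl hp2 hpl hζ hη ι hι hinj Φ hΦ hΦK hZ hN T).pmHat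
      (ofCoverModel e C μ hC hS hl hp2 hpl hζ hη ι hι hinj Φ hΦ hΦK hZ hN T).pmHat) =
        (BadPlaceSetting.ofUnderline C μ hC hS hl hp2 hpl hζ hη).l := by
  let ιW : M.GtpC →* (ofCoverModel e C μ hC hS hl hp2 hpl hζ hη ι hι hinj Φ hΦ hΦK hZ hN T).Corhat := ι.toMonoidHom
  obtain ⟨g, hgX, hgD⟩ := exists_ι_not_mem_closure_conj_map_decomp e ι hι hx₀ huniq h65iii
  refine card_labCuspPM_eq_l_of_inputs_of_sup (C := Cu)
    (J₀ := ((M.toTemperedCurve.inertia x₀).map M.inclX).map ιW)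
    (R := (ofCoverModel e C μ hC hS hl hp2 hpl hζ hη ι hι hinj Φ hΦ hΦK hZ hN T).cor)
    (Xh := (M.inclX.range.map ιW).topologicalClosure) (D := ((M.decomp x₀).map M.inclX).map ιW) (q₁ := ιW g)
    ?_ (cor_sup_pmHat_eq_top e C μ hC hS hl hp2 hpl hζ hη ι hι hinj Φ hΦ hΦK hZ hN T)
    (isCuspidalInertia_pmHat_iff_cor e C μ hC hS hl hp2 hpl hζ hη ι hι hinj Φ hΦ hΦK hZ hN T op hx₀ huniq Cu hCuA)
    (index_closure_range_inclX ι hι) ?_ ?_ (map_decomp_le_normalizer_map_inertia ι) h45vi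
    (fun q hq => conj_smul_map_inertia_of_decomp e ι Φ hΦ q hq) hgX hgD
    (ofCoverModel_indices e C μ hC hS hl hp2 hpl hζ hη ι hι hinj Φ hΦ hΦK hZ hN T).1
  · change (((M.toTemperedCurve.inertia x₀).map M.inclX).map ι.toMonoidHom : Subgroup Q) ≤
      (((M.GtpXu l).map M.inclX).map ι.toMonoidHom).topologicalClosure
    exact (Subgroup.map_mono (Subgroup.map_mono (inertia_le_GtpXu op hx₀))).trans (Subgroup.le_topologicalClosure _)
  · change ((((M.GtpXu l).map M.inclX).map ι.toMonoidHom).topologicalClosure : Subgroup Q) ≤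
      (M.inclX.range.map ι.toMonoidHom).topologicalClosure
    exact Subgroup.topologicalClosure_mono (Subgroup.map_mono (Subgroup.map_le_range _ _))
  · change (((M.decomp x₀).map M.inclX).map ι.toMonoidHom : Subgroup Q) ≤
      (((M.GtpXu l).map M.inclX).map ι.toMonoidHom).topologicalClosure
    exact (Subgroup.map_mono (Subgroup.map_mono (decomp_le_GtpXu op hx₀))).trans (Subgroup.le_topologicalClosure _)

/-- **`|LabCusp^±(Π̂^±_v)| = l` FOR THE TEMPERED DATUM (A) AT THE TOWER OF RECORD `ofPiCHat`** (the B13/B15 datum family of p430433 / abc-iut-L6-t7),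
modulo the named residuals of p449023. ([IUTchII] Def 2.3 (iii)/(v), kurims pp.68–69) [claim: Mochizuki2012, status: disputed] -/
theorem card_labCuspPM_ofPiCHat_eq_l_tempered (op : M.toThetaSetting.OncePuncturedData) (hx₀ : M.IsCusp x₀)
    (huniq : ∀ x' : M.Pt, M.IsCusp x' → x' = x₀) (h65iii : M.toTemperedCurve.IsoPreservesCuspidalDecomp M.toTemperedCurve)
    (h45vi : Subgroup.normalizer ((((M.toTemperedCurve.inertia x₀).map M.inclX).map e.toPiCHat.toMonoidHom : Subgroup e.PiCHat) :
        Set e.PiCHat) ⊓ (M.inclX.range.map e.toPiCHat.toMonoidHom).topologicalClosure ≤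
          ((M.decomp x₀).map M.inclX).map e.toPiCHat.toMonoidHom)
    (Cu : CuspidalInertiaData (ofPiCHat e C μ hC hS hl hp2 hpl hζ hη hZ hN T))
    (hCuA : ∀ Q' J : Subgroup (ofPiCHat e C μ hC hS hl hp2 hpl hζ hη hZ hN T).Corhat,
      Cu.IsCuspidalInertia Q' J ↔ J ≤ Q' ∧ ∃ i : {x : M.Pt // M.IsCusp x} × M.GtpC,
        ∃ t ∈ (ofPiCHat e C μ hC hS hl hp2 hpl hζ hη hZ hN T).piPM,
          J = MulAut.conj t •
            (((MulAut.conj i.2 • (M.toTemperedCurve.inertia i.1.1).map M.inclX) ⊓ (M.GtpXu l).map M.inclX).map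
              e.toPiCHat.toMonoidHom : Subgroup (ofPiCHat e C μ hC hS hl hp2 hpl hζ hη hZ hN T).Corhat)) :
    Nat.card (LabCuspPM Cu (ofPiCHat e C μ hC hS hl hp2 hpl hζ hη hZ hN T).pmHat
      (ofPiCHat e C μ hC hS hl hp2 hpl hζ hη hZ hN T).pmHat) = l :=
  card_labCuspPM_ofCoverModel_eq_l_tempered e C μ hC hS hl hp2 hpl hζ hη e.toPiCHat e.isProfiniteCompletion_toPiCHat
    e.toPiCHat_injective e.piCData.aug.toMonoidHom (fun g => e.piCData_aug_apply g) e.piCData.range_aug hZ hN T op hx₀ huniq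
    h65iii h45vi Cu hCuA

end PlusMinusTower

end Literature.IUT.HodgeArakelov

end
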